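import Summits.ResolutionOfSingularities.ResolutionOfSingularities.Theorems.FrobeniusLadderFInjectiveMacaulayficationX2CubicFormFloorCert
import Summits.ResolutionOfSingularities.ResolutionOfSingularities.Theorems.FrobeniusLadderFInjectiveMacaulayficationX2TwoCubesVertexFull
import HarnessLib

/-!
# (T-I3, first kernel step) THE PINCH-TYPE CHART `g = X₄² + X_a²·W` WITH `V(W)` SMOOTH IS F-PURE (FULL CLAUSE) AT EVERY CLOSED POINT, EVERY ODD PRIME `p`
# — the legality claim «the point floor of `x² + F₄` is FULL although NON-NORMAL» of habitat #3a (`Lines/T-I3-firststep.md`), class level, plus the worked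
# quartic y-chart `W = 1 + X₁⁴ + X₂⁴ − X₃⁴`
# (crux `FInjectiveMacaulayfication` stmt-ResolutionOfSingularities-15315, chain w45a; seat res-L1-w45a-lead-1 g11)

[OURS · L1 W4.5a] Support file (`--supports stmt-ResolutionOfSingularities-15315 --as helper`); def-free; UNCONDITIONAL; no named fact; NOT a statement of any manuscript. A FULLness
tool for the next T″ habitat; evidence for nothing beyond itself; T″ and the F-half OPEN; nothing of the crux proved. AI-written (AI review is weaker than expert review).

The point floor of a quartic double point `x² + F₄` has y-chart `g = x′² + y²·w` (`w = F₄(1,u′,t′,s′)`): singular along the WHOLE reduced exceptional divisor `{x′ = y = 0}`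
(non-normal: two sheets / Whitney umbrellas). Fedder at a prime `𝔫 = (a₁,…,a_m) ∋ g`: if `g^{p−1} ∈ (a_i^p)` =: `I` (derivation-stable), then `∂₄^{p−1}` gives
`(X_a²W)^{(p−1)/2} = X_a^{p−1}W^m ∈ I`, `∂_a^{p−1}` gives `W^m ∈ I ⊆ 𝔫` (`m = (p−1)/2`, `m! , (p−1)!, C(p−1,m)` units): so `W ∈ 𝔫`, and then the contradiction engine
✓p681927 `apply_mem_of_pow_mem` with `∂_b W ∉ 𝔫` (smoothness of `V(W)`) gives `∂_b W ∈ 𝔫` — contradiction. No case distinction on `X_a` is needed.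
* §1 ★★ `pow_not_mem_span_pow_pinch`, ★★ `clause_pinch_smooth` (every maximal ideal of `k[X]/(g)`), `fullCl_stalk_pinch` (`g` prime ⇒ `FullCl` at every closed point).
* §2 the quartic y-chart: `smooth_W4` (`2 ≠ 0`; Euler), `prime_g4` (Eisenstein-type at the rational point `(1,0,0,1)` of `X₀²W`), ★ `fullCl_stalk_quartic_yChart` (every `p ≠ 2`).
[cite: Fedder1983, Prop. 1.7, Thm. 1.12 (context)] [folklore computation]
-/

-- single-problem summit: the doubled namespace component is forced
set_option linter.dupNamespace false

noncomputable section

open MvPolynomial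

namespace Summit.ResolutionOfSingularities.ResolutionOfSingularities.Theorems.FInjectiveMacaulayfication.PinchFloorFull

open Summit.ResolutionOfSingularities.ResolutionOfSingularities.Theorems.FInjectiveMacaulayfication
open AlgebraicGeometry SliceableCentre X2CubicFormFloorCert

variable (k : Type) [Field k]

/-! ## §1 The pinch-type chart, class level -/

/-- ★★ **`g^{p−1} ∉ (a₁^p, …, a_m^p)`** for `g = X₄² + X_a²·W` (`a ≠ 4`, `∂₄W = ∂_aW = 0`, `V(W)` smooth in the pointwise sense), every ODD prime `p`, every prime `𝔫 = (a₁,…,a_m) ∋ g`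
of `k[X₀..X₄]`. [OURS; cite: Fedder1983, Thm. 1.12 (context)] -/
theorem pow_not_mem_span_pow_pinch (p : ℕ) [Fact p.Prime] [CharP k p] (hp2 : p ≠ 2) (a : Fin 5) (ha4 : a ≠ 4) (W g : MvPolynomial (Fin 5) k)
    (hg : g = X 4 ^ 2 + X a ^ 2 * W) (hWa : pderiv a W = 0) (hW4 : pderiv 4 W = 0)
    (hWs : ∀ 𝔮 : Ideal (MvPolynomial (Fin 5) k), 𝔮.IsPrime → W ∈ 𝔮 → ∃ b : Fin 5, pderiv b W ∉ 𝔮)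
    {m : ℕ} (gen : Fin m → MvPolynomial (Fin 5) k) (h𝔫 : (Ideal.span (Set.range gen)).IsPrime) (hg𝔫 : g ∈ Ideal.span (Set.range gen)) :
    g ^ (p - 1) ∉ Ideal.span (Set.range fun i : Fin m => gen i ^ p) := by
  intro hgI
  have hp : p.Prime := Fact.out
  haveI := h𝔫
  set 𝔫 := Ideal.span (Set.range gen) with h𝔫def
  set I := Ideal.span (Set.range fun i : Fin m => gen i ^ p) with hIdef
  have hI : I ≤ 𝔫 := by
    rw [hIdef, Ideal.span_le]
    rintro _ ⟨i, rfl⟩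
    exact 𝔫.pow_mem_of_mem (Ideal.subset_span ⟨i, rfl⟩) _ hp.pos
  have hID : ∀ (D : Derivation k (MvPolynomial (Fin 5) k) (MvPolynomial (Fin 5) k)), ∀ x ∈ I, D x ∈ I := fun D x hx => derivation_mem_span_pow p k gen D hx
  have _ := hg𝔫
  -- stage 1: `∂₄^{p−1}(g^{p−1}) = (p−1)!·C(p−1,m)·(X_a²W)^m`
  have hc4 : pderiv 4 (X a ^ 2 * W : MvPolynomial (Fin 5) k) = 0 := by
    rw [Derivation.leibniz, Derivation.leibniz_pow, pderiv_X_of_ne ha4, hW4]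
    simp
  have h1 := iterate_derivation_mem_span_pow p k gen (pderiv 4 : Derivation k (MvPolynomial (Fin 5) k) (MvPolynomial (Fin 5) k)) (p - 1) hgI
  have h1' : (fun q => (pderiv 4 : Derivation k (MvPolynomial (Fin 5) k) (MvPolynomial (Fin 5) k)) q)^[p - 1] (g ^ (p - 1)) =
      (((p - 1).factorial * (p - 1).choose ((p - 1) / 2) : ℕ) : MvPolynomial (Fin 5) k) * (X a ^ 2 * W) ^ ((p - 1) / 2) :=
    X2Cubic4VertexFull.iterate_pderiv_f_pow k p hp2 g (X a ^ 2 * W) hg hc4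
  rw [h1'] at h1
  have hN1 : ((((p - 1).factorial * (p - 1).choose ((p - 1) / 2) : ℕ)) : k) ≠ 0 := by
    rw [Nat.cast_mul]
    exact mul_ne_zero (X2Cubic4VertexFull.factorial_cast_ne_zero k p _ (Nat.sub_lt hp.pos Nat.one_pos))
      (X2Cubic4VertexFull.choose_cast_ne_zero k p _ _ (Nat.div_le_self _ _) (Nat.sub_lt hp.pos Nat.one_pos))
  have hcm : (X a ^ 2 * W) ^ ((p - 1) / 2) ∈ I := X2Cubic4VertexFull.mem_of_natCast_mul_mem k hN1 I _ h1
  -- `(X_a²W)^m = X_a^{p−1}·W^m`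
  have hodd : p % 2 = 1 := hp.eq_two_or_odd.resolve_left hp2
  have hcm' : X a ^ (p - 1) * W ^ ((p - 1) / 2) ∈ I := by
    have e : (X a ^ 2 * W : MvPolynomial (Fin 5) k) ^ ((p - 1) / 2) = X a ^ (p - 1) * W ^ ((p - 1) / 2) := by
      rw [mul_pow, ← pow_mul, show 2 * ((p - 1) / 2) = p - 1 by omega]
    rwa [e] at hcm
  -- stage 2: `∂_a^{p−1}(X_a^{p−1}·W^m) = (p−1)!·W^m`
  have hWm : pderiv a (W ^ ((p - 1) / 2)) = 0 := by rw [Derivation.leibniz_pow, hWa, smul_zero, smul_zero]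
  have h2 := iterate_derivation_mem_span_pow p k gen (pderiv a : Derivation k (MvPolynomial (Fin 5) k) (MvPolynomial (Fin 5) k)) (p - 1) hcm'
  have h2' : (fun q => (pderiv a : Derivation k (MvPolynomial (Fin 5) k) (MvPolynomial (Fin 5) k)) q)^[p - 1] (X a ^ (p - 1) * W ^ ((p - 1) / 2)) =
      (((p - 1).factorial : ℕ) : MvPolynomial (Fin 5) k) * W ^ ((p - 1) / 2) := by
    have := X2Cubic4FloorFullCert.iterate_pderiv_X_pow_mul a (W ^ ((p - 1) / 2)) hWm (p - 1) (p - 1)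
    rw [Nat.descFactorial_self, Nat.sub_self, pow_zero, one_mul] at this
    exact this
  rw [h2'] at h2
  have hWpow : W ^ ((p - 1) / 2) ∈ I :=
    X2Cubic4VertexFull.mem_of_natCast_mul_mem k (X2Cubic4VertexFull.factorial_cast_ne_zero k p _ (Nat.sub_lt hp.pos Nat.one_pos)) I _ h2
  -- `W ∈ 𝔫`, then the contradiction engine with `∂_b W ∉ 𝔫`
  have hW : W ∈ 𝔫 := h𝔫.mem_of_pow_mem _ (hI hWpow)
  obtain ⟨b, hb⟩ := hWs 𝔫 h𝔫 hW
  have hfac : IsUnit (((((p - 1) / 2).factorial : ℕ)) : MvPolynomial (Fin 5) k) := by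
    rw [← map_natCast (C : k →+* MvPolynomial (Fin 5) k)]
    exact (Ne.isUnit (X2Cubic4VertexFull.factorial_cast_ne_zero k p _ (by omega))).map C
  exact hb (apply_mem_of_pow_mem (pderiv b : Derivation k (MvPolynomial (Fin 5) k) (MvPolynomial (Fin 5) k)) W ((p - 1) / 2) hfac I 𝔫 hI (hID _) hW hWpow)

/-- ★★ **THE FULL CLAUSE AT EVERY CLOSED POINT OF THE PINCH-TYPE CHART `k[X]/(X₄² + X_a²W)`** (`V(W)` smooth, `g ≠ 0`, `p` odd): every parameter ideal of the local ring at a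
maximal ideal is generated by a regular sequence and is Frobenius closed. [OURS · assembly; cite: Fedder1983, Prop. 1.7, Thm. 1.12] -/
theorem clause_pinch_smooth (p : ℕ) [Fact p.Prime] [CharP k p] (hp2 : p ≠ 2) (a : Fin 5) (ha4 : a ≠ 4) (W g : MvPolynomial (Fin 5) k)
    (hg : g = X 4 ^ 2 + X a ^ 2 * W) (hWa : pderiv a W = 0) (hW4 : pderiv 4 W = 0) (hg0 : g ≠ 0)
    (hWs : ∀ 𝔮 : Ideal (MvPolynomial (Fin 5) k), 𝔮.IsPrime → W ∈ 𝔮 → ∃ b : Fin 5, pderiv b W ∉ 𝔮)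
    (Q : Ideal (MvPolynomial (Fin 5) k ⧸ Ideal.span {g})) [Q.IsMaximal] :
    ∀ d : ℕ, ringKrullDim (Localization.AtPrime Q) = d → ∀ s : Fin d → Localization.AtPrime Q,
      (Ideal.span (Set.range s)).radical.IsMaximal →
        RingTheory.Sequence.IsWeaklyRegular (Localization.AtPrime Q) (List.ofFn s) ∧
        ∀ y : Localization.AtPrime Q, (∃ e : ℕ, y ^ p ^ e ∈ Ideal.span
          ((fun z : Localization.AtPrime Q => z ^ p ^ e) ''
            (Ideal.span (Set.range s) : Set (Localization.AtPrime Q)))) → y ∈ Ideal.span (Set.range s) := by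
  obtain ⟨m, gen, hgen⟩ := Submodule.fg_iff_exists_fin_generating_family.mp (IsNoetherian.noetherian (Q.comap (Ideal.Quotient.mk (Ideal.span {g}))))
  have hP : Q.comap (Ideal.Quotient.mk (Ideal.span {g})) = Ideal.span (Set.range gen) := hgen.symm
  have hprime : (Ideal.span (Set.range gen)).IsPrime := by rw [← hP]; exact Ideal.comap_isPrime _ Q
  have hgm : g ∈ Ideal.span (Set.range gen) := by
    rw [← hP, Ideal.mem_comap, Ideal.Quotient.eq_zero_iff_mem.mpr (Ideal.mem_span_singleton_self g)]
    exact Q.zero_mem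
  exact FedderAtMaximalIdeal.stub_fedderAtMaximalIdeal p k 5 m gen g Q hP hg0 (pow_not_mem_span_pow_pinch k p hp2 a ha4 W g hg hWa hW4 hWs gen hprime hgm)

/-- **`FullCl` at every closed point of `Spec k[X]/(X₄² + X_a²W)`** when in addition `g` is prime (`p` odd, `V(W)` smooth). [OURS · assembly] -/
theorem fullCl_stalk_pinch (p : ℕ) [Fact p.Prime] [CharP k p] (hp2 : p ≠ 2) (a : Fin 5) (ha4 : a ≠ 4) (W g : MvPolynomial (Fin 5) k)
    (hg : g = X 4 ^ 2 + X a ^ 2 * W) (hWa : pderiv a W = 0) (hW4 : pderiv 4 W = 0) (hprime : Prime g)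
    (hWs : ∀ 𝔮 : Ideal (MvPolynomial (Fin 5) k), 𝔮.IsPrime → W ∈ 𝔮 → ∃ b : Fin 5, pderiv b W ∉ 𝔮)
    (y : Spec (.of (MvPolynomial (Fin 5) k ⧸ Ideal.span {g}))) (hy : y.asIdeal.IsMaximal) :
    FullCl p ((Spec (.of (MvPolynomial (Fin 5) k ⧸ Ideal.span {g}))).presheaf.stalk y) := by
  haveI := (Ideal.span_singleton_prime hprime.ne_zero).mpr hprime
  haveI : IsDomain (MvPolynomial (Fin 5) k ⧸ Ideal.span {g}) := Ideal.Quotient.isDomain _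
  haveI := hy
  haveI : IsDomain (Localization.AtPrime y.asIdeal) :=
    IsLocalization.isDomain_of_le_nonZeroDivisors _ y.asIdeal.primeCompl_le_nonZeroDivisors
  have hloc : FullCl p (Localization.AtPrime y.asIdeal) :=
    ⟨inferInstance, clause_pinch_smooth k p hp2 a ha4 W g hg hWa hW4 hprime.ne_zero hWs y.asIdeal⟩
  exact WFixAtNonClosedDimTwo.fullCl_of_ringEquiv p (Spec.stalkIso (.of _) y).commRingCatIsoToRingEquiv.symm hloc

/-! ## §2 The quartic y-chart `g = X₄² + X₀²·(1 + X₁⁴ + X₂⁴ − X₃⁴)` -/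

/-- **`V(W)` is smooth for `W = 1 + X₁⁴ + X₂⁴ − X₃⁴`** when `2 ≠ 0` (Euler: `W − Σ (X_b/4)∂_bW = 1`). [elementary] -/
theorem smooth_W4 (h2 : (2 : k) ≠ 0) :
    ∀ 𝔮 : Ideal (MvPolynomial (Fin 5) k), 𝔮.IsPrime → (1 + X 1 ^ 4 + X 2 ^ 4 - X 3 ^ 4 : MvPolynomial (Fin 5) k) ∈ 𝔮 →
      ∃ b : Fin 5, pderiv b (1 + X 1 ^ 4 + X 2 ^ 4 - X 3 ^ 4 : MvPolynomial (Fin 5) k) ∉ 𝔮 := by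
  intro 𝔮 h𝔮 hW
  by_contra hall
  push Not at hall
  have d1 : pderiv 1 (1 + X 1 ^ 4 + X 2 ^ 4 - X 3 ^ 4 : MvPolynomial (Fin 5) k) = 4 * X 1 ^ 3 := by
    simp only [map_add, map_sub, Derivation.map_one_eq_zero, Derivation.leibniz_pow, pderiv_X_self, pderiv_X_of_ne (show (2 : Fin 5) ≠ 1 by decide),
      pderiv_X_of_ne (show (3 : Fin 5) ≠ 1 by decide), zero_add, smul_eq_mul, mul_one, nsmul_eq_mul]
    push_cast; ring
  have d2 : pderiv 2 (1 + X 1 ^ 4 + X 2 ^ 4 - X 3 ^ 4 : MvPolynomial (Fin 5) k) = 4 * X 2 ^ 3 := by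
    simp only [map_add, map_sub, Derivation.map_one_eq_zero, Derivation.leibniz_pow, pderiv_X_self, pderiv_X_of_ne (show (1 : Fin 5) ≠ 2 by decide),
      pderiv_X_of_ne (show (3 : Fin 5) ≠ 2 by decide), zero_add, smul_eq_mul, mul_one, nsmul_eq_mul]
    push_cast; ring
  have d3 : pderiv 3 (1 + X 1 ^ 4 + X 2 ^ 4 - X 3 ^ 4 : MvPolynomial (Fin 5) k) = -(4 * X 3 ^ 3) := by
    simp only [map_add, map_sub, Derivation.map_one_eq_zero, Derivation.leibniz_pow, pderiv_X_self, pderiv_X_of_ne (show (1 : Fin 5) ≠ 3 by decide),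
      pderiv_X_of_ne (show (2 : Fin 5) ≠ 3 by decide), zero_add, smul_eq_mul, mul_one, nsmul_eq_mul]
    push_cast; ring
  have h4 : (4 : k) ≠ 0 := by
    rw [show (4 : k) = 2 * 2 by norm_num]; exact mul_ne_zero h2 h2
  have e : (C (4 : k)⁻¹ : MvPolynomial (Fin 5) k) * (4 * (1 + X 1 ^ 4 + X 2 ^ 4 - X 3 ^ 4) - X 1 * (4 * X 1 ^ 3) - X 2 * (4 * X 2 ^ 3) - X 3 * (-(4 * X 3 ^ 3))) = 1 := by
    have h4C : (C (4 : k)⁻¹ : MvPolynomial (Fin 5) k) * 4 = 1 := by rw [← map_ofNat C 4, ← map_mul, inv_mul_cancel₀ h4, map_one]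
    linear_combination h4C
  apply h𝔮.ne_top
  rw [Ideal.eq_top_iff_one, ← e]
  refine 𝔮.mul_mem_left _ (𝔮.sub_mem (𝔮.sub_mem (𝔮.sub_mem (𝔮.mul_mem_left _ hW) (𝔮.mul_mem_left _ ?_)) (𝔮.mul_mem_left _ ?_)) (𝔮.mul_mem_left _ ?_))
  · rw [← d1]; exact hall 1
  · rw [← d2]; exact hall 2
  · rw [← d3]; exact hall 3

/-- **`g = X₄² + X₀²(1 + X₁⁴ + X₂⁴ − X₃⁴)` is prime** when `2 ≠ 0`: `T² + C(c)`, `c = X₀²W`, Eisenstein-type at the rational point `(1, 0, 0, 1)` of `c` (`∂₃c = −4 ≠ 0` there). [folklore] -/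
theorem prime_g4 (h2 : (2 : k) ≠ 0) (g : MvPolynomial (Fin 5) k) (hg : g = X 4 ^ 2 + X 0 ^ 2 * (1 + X 1 ^ 4 + X 2 ^ 4 - X 3 ^ 4)) : Prime g := by
  set e : MvPolynomial (Fin 5) k ≃+* Polynomial (MvPolynomial (Fin 4) k) :=
    ((renameEquiv k (_root_.finRotate 5)).trans (finSuccEquiv k 4)).toRingEquiv with he_def
  have hrot4 : (_root_.finRotate 5) (4 : Fin 5) = 0 := by decide
  have hrot : ∀ j : Fin 4, (_root_.finRotate 5) (Fin.castSucc j) = j.succ := by decide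
  have he4 : e (X 4) = Polynomial.X := by
    show finSuccEquiv k 4 (rename _ (X 4)) = _
    rw [rename_X, hrot4]; exact finSuccEquiv_X_zero
  have hej : ∀ j : Fin 4, e (X (Fin.castSucc j)) = Polynomial.C (X j) := fun j => by
    show finSuccEquiv k 4 (rename _ (X (Fin.castSucc j))) = _
    rw [rename_X, hrot j]; exact finSuccEquiv_X_succ (j := j)
  set c : MvPolynomial (Fin 4) k := X 0 ^ 2 * (1 + X 1 ^ 4 + X 2 ^ 4 - X 3 ^ 4) with hc
  have hef : e g = Polynomial.X ^ 2 + Polynomial.C (0 : MvPolynomial (Fin 4) k) * Polynomial.X + Polynomial.C c := by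
    rw [hg, map_add, map_pow, he4, map_mul, map_pow, map_sub, map_add, map_add, map_one, map_pow, map_pow, map_pow,
      show (0 : Fin 5) = Fin.castSucc (0 : Fin 4) from rfl, show (1 : Fin 5) = Fin.castSucc (1 : Fin 4) from rfl,
      show (2 : Fin 5) = Fin.castSucc (2 : Fin 4) from rfl, show (3 : Fin 5) = Fin.castSucc (3 : Fin 4) from rfl, hej, hej, hej, hej, hc]
    simp only [map_add, map_sub, map_mul, map_pow, map_one, map_zero, zero_mul, add_zero]
  set a : Fin 4 → k := ![1, 0, 0, 1] with ha
  have hba : MvPolynomial.eval a (0 : MvPolynomial (Fin 4) k) = 0 := map_zero _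
  have hca : MvPolynomial.eval a c = 0 := by
    rw [hc]
    simp only [map_add, map_sub, map_mul, map_pow, map_one, eval_X, ha, Matrix.cons_val_zero, Matrix.cons_val_one]
    simp only [Matrix.cons_val]
    ring
  have hder : MvPolynomial.eval a (pderiv 3 c) ≠ 0 := by
    have e1 : pderiv 3 c = -(4 * X 0 ^ 2 * X 3 ^ 3) := by
      rw [hc]
      simp only [map_add, map_sub, Derivation.map_one_eq_zero, Derivation.leibniz, Derivation.leibniz_pow, pderiv_X_self,
        pderiv_X_of_ne (show (0 : Fin 4) ≠ 3 by decide), pderiv_X_of_ne (show (1 : Fin 4) ≠ 3 by decide), pderiv_X_of_ne (show (2 : Fin 4) ≠ 3 by decide),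
        zero_add, smul_eq_mul, mul_one, nsmul_eq_mul]
      push_cast; ring
    rw [e1, map_neg, map_mul, map_mul, map_pow, map_pow, eval_X, eval_X, ha]
    simp only [Matrix.cons_val_zero, Matrix.cons_val]
    rw [map_ofNat]
    have h4 : (4 : k) ≠ 0 := by rw [show (4 : k) = 2 * 2 by norm_num]; exact mul_ne_zero h2 h2
    simpa using h4
  have hirr : Irreducible (e g) := by
    rw [hef]
    exact Literature.AlgebraicGeometry.Motives.SmoothHypersurface.irreducible_X_pow_add_C_mul_X_add_C (d := 2) le_rfl 0 c a hba hca 3 hder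
  exact (MulEquiv.prime_iff e).mp hirr.prime

/-- ★ **THE QUARTIC y-CHART `k[X]/(X₄² + X₀²(1 + X₁⁴ + X₂⁴ − X₃⁴))` IS FULL AT EVERY CLOSED POINT, every prime `p ≠ 2`** — although it is singular along the whole 3-fold
`{X₄ = X₀ = 0}` (non-normal). First kernel fact of habitat #3a. [OURS · application] -/
theorem fullCl_stalk_quartic_yChart (p : ℕ) [Fact p.Prime] [CharP k p] (hp2 : p ≠ 2) (g : MvPolynomial (Fin 5) k)
    (hg : g = X 4 ^ 2 + X 0 ^ 2 * (1 + X 1 ^ 4 + X 2 ^ 4 - X 3 ^ 4))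
    (y : Spec (.of (MvPolynomial (Fin 5) k ⧸ Ideal.span {g}))) (hy : y.asIdeal.IsMaximal) :
    FullCl p ((Spec (.of (MvPolynomial (Fin 5) k ⧸ Ideal.span {g}))).presheaf.stalk y) := by
  have h2 : (2 : k) ≠ 0 := by exact_mod_cast X2Cubic4Specimen.natCast_ne_zero_of_prime_ne k p 2 (by norm_num) hp2
  refine fullCl_stalk_pinch k p hp2 0 (by decide) (1 + X 1 ^ 4 + X 2 ^ 4 - X 3 ^ 4) g hg ?_ ?_ (prime_g4 k h2 g hg) (smooth_W4 k h2) y hy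
  · simp only [map_add, map_sub, Derivation.map_one_eq_zero, Derivation.leibniz_pow, pderiv_X_of_ne (show (1 : Fin 5) ≠ 0 by decide),
      pderiv_X_of_ne (show (2 : Fin 5) ≠ 0 by decide), pderiv_X_of_ne (show (3 : Fin 5) ≠ 0 by decide), smul_zero, add_zero, sub_zero]
  · simp only [map_add, map_sub, Derivation.map_one_eq_zero, Derivation.leibniz_pow, pderiv_X_of_ne (show (1 : Fin 5) ≠ 4 by decide),
      pderiv_X_of_ne (show (2 : Fin 5) ≠ 4 by decide), pderiv_X_of_ne (show (3 : Fin 5) ≠ 4 by decide), smul_zero, add_zero, sub_zero]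

end Summit.ResolutionOfSingularities.ResolutionOfSingularities.Theorems.FInjectiveMacaulayfication.PinchFloorFull

end
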